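import Mathlib
import Summits.NavierStokesRegularity.NavierStokesRegularity.Theorems.WakeRatchetTailEnvelopeFinite
import Summits.NavierStokesRegularity.NavierStokesRegularity.Theses.WakeRatchet
import HarnessLib

/-!
# `WakeRatchet.TailRatchet` (item stmt-NavierStokesRegularity-21808) on the DSS stratum:
# the tail ratchet is a LIOUVILLE statement for discretely self-similar eternal solutions

Support lemmas for the crux `TailRatchet` (route `WakeRatchet`, rung TL-M2Break of the Tao-ladder
MODEL lattice; nothing here is a statement about the Navier–Stokes equations) and for the
plan-only BC5 rung `stub_rung_dss` of its registered skeleton `Cruxes/TailRatchet/Lines/birth.lean`.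

THE REDUCTION.  If a family `W : ℤ → ℝ → ℝ^m` is BLOCK-SELF-SIMILAR, `W_{n+p}(σ) = W_n(σ − T)` for a
shell period `p ≥ 1` and a log-time lag `T` (a single-profile DSS front is `p = 1`; the eternal
solution `dssEmbed π T Φ r₀` carried by an admissible DSS wave of period `q` is block-self-similar
with `p = orderOf π`, lag `pT`), then every tail energy obeys the EXACT identity
`Σ_{k≥0} E_{n+p+k}(σ) = ϱ · Σ_{k≥0} E_{n+k}(σ − T)`, `ϱ = e^{2T} Λ^{-2p}` (`tail_shift`; for `p = 1`,
`ϱ = dssMu ε₀ T`).  Consequently (`ratio_le_of_contraction`): if the tail envelopes of a NON-TRIVIAL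
bounded admissible eternal block-self-similar solution on a cancelling table contract by `1 − w` per
shell (the conclusion of `TailRatchet`), then `ϱ ≤ (1 − w)^p`; but a positive lag forces
`ϱ > Λ^{-2p} = (1+ε₀)^{-5p}` (the tree's `inv_pow_lt_dssMu` for `p = 1`), so as soon as
`(1+ε₀)^5 (1 − w) ≤ 1` — i.e. for every `ε₀ ≤ w/5` — NO such solution exists (`trivial_of_contraction`).

MAIN CONSEQUENCES (kernel-checked, sorry-free):
* `no_blockDSS_of_tailRatchet` / `no_dssWave_of_tailRatchet`: `TailRatchet` implies that below a
  threshold `ε₁(R) > 0` NO table of E₂(R) carries a non-trivial admissible DSS wave (`IsDSSWave`, any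
  period, any delay) AT ALL — not merely no (S₁)-surviving one; in particular
  `TailRatchet → NoSurvivingDSS R a` for every `a` (`noSurvivingDSS_of_tailRatchet`).
* KILL CRITERIA (companion file `Theorems/WakeRatchetTailRatchet/Negative/…`): admissible
  non-trivial DSS waves — surviving OR NOT, of any residue — on E₂(R) tables (e.g. on the dyadic
  member `dyadicTable ∈ E₂(2)`) at arbitrarily small scale ratios refute `TailRatchet`.
* The same for the DSS rung (`stub_rung_dss`'s statement, quoted verbatim as a hypothesis):
  `no_front_of_dssRung`, `not_dssRung_of_persistent_fronts` — the rung is not a wake-floor inequality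
  on `dssMu` but the non-existence of single-profile bounded eternal DSS fronts below threshold; and
  conversely the wake-floor form `dssMu ≤ 1 − w` is exactly sufficient for its contraction
  (`contraction_of_dssMu_le`).

HONEST FRAMING: bookkeeping about solutions of Tao-type MODEL lattice ODEs (Tao 2016 §4 in the
renormalised variables of §6.4); no summit statement is touched.
-/

noncomputable section

set_option linter.dupNamespace false

namespace Summit.NavierStokesRegularity.NavierStokesRegularity.Theorems

namespace WakeRatchetDSS

open Filter Topology
open Literature.Analysis.FluidPDE Literature.Analysis.FluidPDE.TaoCascade
open WakeRatchetTail

variable {m : ℕ} {ε₀ : ℝ} {W : ℤ → ℝ → Em m}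

/-! ## The block-self-similar tail identity -/

/-! Throughout, the PER-BLOCK ENERGY RATIO of a block-self-similar family with shell period `p` and
lag `T` is written out as `Real.exp (2 * T) * (bigLam ε₀ ^ p)⁻¹ ^ 2` (`= e^{2T} Λ^{-2p}`; for `p = 1`
it is `dssMu ε₀ T`). -/

/-- For shell period `1` the block ratio is `dssMu ε₀ T = e^{2T}/(1+ε₀)^5`.
[cite: Tao2016AveragedNS, §4 (4.1); cell vocabulary] -/
theorem blockRatio_one (hε : 0 ≤ ε₀) (T : ℝ) :
    Real.exp (2 * T) * (bigLam ε₀ ^ 1)⁻¹ ^ 2 = dssMu ε₀ T := by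
  unfold dssMu
  rw [pow_one, inv_pow, bigLam_sq hε, div_eq_mul_inv]

/-- The block ratio is positive. [cite: Tao2016AveragedNS, §4 (4.1); elementary] -/
theorem blockRatio_pos (hε : 0 < ε₀) (p : ℕ) (T : ℝ) :
    0 < Real.exp (2 * T) * (bigLam ε₀ ^ p)⁻¹ ^ 2 := by
  have hb : 0 < bigLam ε₀ := bigLam_pos (by linarith)
  positivity

/-- A positive lag caps the block ratio from below: `Λ^{-2p} < ϱ`.
[cite: Tao2016AveragedNS, §4 (4.1); elementary (`1 < e^{2T}`)] -/
theorem inv_sq_lt_blockRatio (hε : 0 < ε₀) (p : ℕ) {T : ℝ} (hT : 0 < T) :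
    (bigLam ε₀ ^ p)⁻¹ ^ 2 < Real.exp (2 * T) * (bigLam ε₀ ^ p)⁻¹ ^ 2 := by
  have hb : 0 < bigLam ε₀ := bigLam_pos (by linarith)
  have hpos : 0 < (bigLam ε₀ ^ p)⁻¹ ^ 2 := by positivity
  have he : 1 < Real.exp (2 * T) := Real.one_lt_exp_iff.2 (by linarith)
  calc (bigLam ε₀ ^ p)⁻¹ ^ 2 = 1 * (bigLam ε₀ ^ p)⁻¹ ^ 2 := (one_mul _).symm
    _ < Real.exp (2 * T) * (bigLam ε₀ ^ p)⁻¹ ^ 2 := mul_lt_mul_of_pos_right he hpos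

/-- `Λ^{-2p} = ((1+ε₀)^5)^{-p}`. [cite: Tao2016AveragedNS, §4 (4.1); elementary] -/
theorem inv_bigLam_pow_sq (hε : 0 ≤ ε₀) (p : ℕ) :
    (bigLam ε₀ ^ p)⁻¹ ^ 2 = (((1 + ε₀) ^ 5)⁻¹) ^ p := by
  rw [inv_pow, ← pow_mul, mul_comm, pow_mul, bigLam_sq hε, inv_pow]

/-- **Shell identity.** For a block-self-similar family, `E_{n+p}(σ) = ϱ · E_n(σ − T)`.
[cite: Tao2016AveragedNS, §4 Lemma 4.1 (4.10) in the self-similar variables of §6.4; cell vocabulary (DSS ansatz)] -/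
theorem physEnergy_shift (hε : 0 < ε₀) {p : ℕ} {T : ℝ}
    (hD : ∀ (n : ℤ) (σ : ℝ), W (n + p) σ = W n (σ - T)) (n : ℤ) (σ : ℝ) :
    physEnergy ε₀ W (n + p) σ =
      Real.exp (2 * T) * (bigLam ε₀ ^ p)⁻¹ ^ 2 * physEnergy ε₀ W n (σ - T) := by
  have hb : 0 < bigLam ε₀ := bigLam_pos (by linarith)
  unfold physEnergy
  rw [hD n σ, zpow_add₀ hb.ne', zpow_natCast]
  have he : Real.exp (2 * σ) = Real.exp (2 * T) * Real.exp (2 * (σ - T)) := by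
    rw [← Real.exp_add]; ring_nf
  rw [he, mul_inv, mul_pow]
  ring

/-- **Tail identity.** For a block-self-similar family,
`Σ_{k≥0} E_{n+p+k}(σ) = ϱ · Σ_{k≥0} E_{n+k}(σ − T)`.
[cite: Tao2016AveragedNS, §4 Lemma 4.1 (4.10), §6.4; cell vocabulary (DSS ansatz)] -/
theorem tail_shift (hε : 0 < ε₀) {p : ℕ} {T : ℝ}
    (hD : ∀ (n : ℤ) (σ : ℝ), W (n + p) σ = W n (σ - T)) (n : ℤ) (σ : ℝ) :
    ∑' k : ℕ, physEnergy ε₀ W (n + p + k) σ =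
      Real.exp (2 * T) * (bigLam ε₀ ^ p)⁻¹ ^ 2 * ∑' k : ℕ, physEnergy ε₀ W (n + k) (σ - T) := by
  rw [← tsum_mul_left]
  refine tsum_congr fun k => ?_
  rw [show n + (p : ℤ) + (k : ℤ) = n + k + p by ring]
  exact physEnergy_shift hε hD (n + k) σ

/-! ## The wake-floor form is sufficient for the DSS rung -/

/-- If the per-shell ratio of a single-profile DSS family obeys the WAKE FLOOR `dssMu ε₀ T ≤ 1 − w`,
then its tail envelopes contract by `1 − w` per shell (the conclusion of `TailRatchet` /
`stub_rung_dss` for this family).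
[cite: Tao2016AveragedNS, §4 Lemma 4.1 (4.10), §6.4; cell vocabulary] -/
theorem contraction_of_dssMu_le (hε : 0 < ε₀) {T w M : ℝ} {n : ℤ}
    (hD : ∀ (n : ℤ) (σ : ℝ), W (n + 1) σ = W n (σ - T)) (hμ : dssMu ε₀ T ≤ 1 - w)
    (hM : ∀ σ : ℝ, ∑' k : ℕ, physEnergy ε₀ W (n + k) σ ≤ M) (σ : ℝ) :
    ∑' k : ℕ, physEnergy ε₀ W (n + 1 + k) σ ≤ (1 - w) * M := by
  have hD' : ∀ (n : ℤ) (σ : ℝ), W (n + (1 : ℕ)) σ = W n (σ - T) := fun n σ => by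
    simpa using hD n σ
  have h := tail_shift hε hD' n σ
  simp only [Nat.cast_one] at h
  rw [h, blockRatio_one hε.le]
  have hM0 : 0 ≤ M :=
    (tsum_nonneg fun k : ℕ => physEnergy_nonneg ε₀ W (n + (k : ℤ)) (σ - T)).trans (hM (σ - T))
  have hμ0 : 0 ≤ dssMu ε₀ T := (dssMu_pos T (by linarith)).le
  calc dssMu ε₀ T * ∑' k : ℕ, physEnergy ε₀ W (n + k) (σ - T)
      ≤ dssMu ε₀ T * M := mul_le_mul_of_nonneg_left (hM (σ - T)) hμ0
    _ ≤ (1 - w) * M := mul_le_mul_of_nonneg_right hμ hM0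

/-! ## Contraction forces `ϱ ≤ (1 − w)^p` for non-trivial solutions -/

/-- Iterating the per-shell contraction from shell `n`: `Σ_k E_{n+j+k}(σ) ≤ (1−w)^j M` for a bound
`M` of the tail at shell `n`. [cite: Tao2016AveragedNS, §4 (statement shape only); elementary induction] -/
theorem tail_le_pow_from {w M : ℝ} {n : ℤ}
    (hM : ∀ σ : ℝ, ∑' k : ℕ, physEnergy ε₀ W (n + k) σ ≤ M)
    (hContr : ∀ (n : ℤ) (M : ℝ), (∀ σ : ℝ, ∑' k : ℕ, physEnergy ε₀ W (n + k) σ ≤ M) →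
      ∀ σ : ℝ, ∑' k : ℕ, physEnergy ε₀ W (n + 1 + k) σ ≤ (1 - w) * M) :
    ∀ (j : ℕ) (σ : ℝ), ∑' k : ℕ, physEnergy ε₀ W (n + j + k) σ ≤ (1 - w) ^ j * M := by
  intro j
  induction j with
  | zero => intro σ; simpa using hM σ
  | succ j ih =>
    intro σ
    have h := hContr (n + j) ((1 - w) ^ j * M) ih σ
    have e : n + ((j + 1 : ℕ) : ℤ) = n + j + 1 := by push_cast; ring
    rw [e, pow_succ]
    calc ∑' k : ℕ, physEnergy ε₀ W (n + j + 1 + k) σ ≤ (1 - w) * ((1 - w) ^ j * M) := h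
      _ = (1 - w) ^ j * (1 - w) * M := by ring

/-- A non-zero shell value makes the tail envelope at that shell positive.
[cite: Tao2016AveragedNS, §4 Lemma 4.1 (4.10); elementary] -/
theorem physEnergy_pos_of_ne (hε : 0 < ε₀) {n : ℤ} {σ : ℝ} (hne : W n σ ≠ 0) :
    0 < physEnergy ε₀ W n σ := by
  have hb : 0 < bigLam ε₀ := bigLam_pos (by linarith)
  have hn : 0 < ‖W n σ‖ := norm_pos_iff.2 hne
  unfold physEnergy
  positivity

/-- **Contraction pins the block ratio.** On a cancelling table, a NON-TRIVIAL uniformly bounded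
admissible eternal solution that is block-self-similar (`W_{n+p}(σ) = W_n(σ − T)`) and whose tail
envelopes contract by `1 − w` per shell has `ϱ = e^{2T}Λ^{-2p} ≤ (1 − w)^p`.  (The tail envelope
`Θ_n = sup_σ Σ_k E_{n+k}(σ)` is finite by `TailEnvelopeFinite`, positive at a non-zero shell, and
`Θ_{n+p} = ϱ Θ_n` by `tail_shift`.)
[cite: Tao2016AveragedNS, §4 Lemma 4.1 (4.8)–(4.10), §6.4; cell vocabulary] -/
theorem ratio_le_of_contraction (hε : 0 < ε₀) {α : Fin m → Fin m → Fin m → ℤ × ℤ × ℤ → ℝ}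
    (hc : IsCancellingCoeff α) (hW : IsEternal ε₀ α W) (hU : UniformBound W) {p : ℕ} {T w : ℝ}
    (hD : ∀ (n : ℤ) (σ : ℝ), W (n + p) σ = W n (σ - T))
    (hContr : ∀ (n : ℤ) (M : ℝ), (∀ σ : ℝ, ∑' k : ℕ, physEnergy ε₀ W (n + k) σ ≤ M) →
      ∀ σ : ℝ, ∑' k : ℕ, physEnergy ε₀ W (n + 1 + k) σ ≤ (1 - w) * M)
    {n₀ : ℤ} {σ₀ : ℝ} (hne : W n₀ σ₀ ≠ 0) :
    Real.exp (2 * T) * (bigLam ε₀ ^ p)⁻¹ ^ 2 ≤ (1 - w) ^ p := by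
  set ϱ : ℝ := Real.exp (2 * T) * (bigLam ε₀ ^ p)⁻¹ ^ 2 with hϱ
  -- the tail envelope at shell `n₀`
  set Θ : ℝ → ℝ := fun σ => ∑' k : ℕ, physEnergy ε₀ W (n₀ + k) σ with hΘ
  obtain ⟨M, hM⟩ := TailEnvelopeFinite.main hε hc hW.isEternalVisc hU n₀
  have hbdd : BddAbove (Set.range Θ) := ⟨M, by rintro _ ⟨σ, rfl⟩; exact hM σ⟩
  set S : ℝ := ⨆ σ, Θ σ with hS
  have hle : ∀ σ, Θ σ ≤ S := fun σ => le_ciSup hbdd σ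
  -- `S > 0` from the non-zero shell value
  have hSpos : 0 < S :=
    lt_of_lt_of_le (lt_of_lt_of_le (physEnergy_pos_of_ne hε hne) (physEnergy_le_tail hε hU n₀ σ₀))
      (hle σ₀)
  -- contraction iterated `p` times, then the tail identity
  have hp := tail_le_pow_from (w := w) hle hContr p
  have hρ0 : 0 ≤ ϱ := (blockRatio_pos hε p T).le
  have hall : ∀ σ, ϱ * Θ σ ≤ (1 - w) ^ p * S := by
    intro σ
    have h1 := hp (σ + T)
    rw [tail_shift hε hD n₀ (σ + T), add_sub_cancel_right] at h1
    exact h1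
  have hmul : ϱ * S ≤ (1 - w) ^ p * S := by
    rw [hS, Real.mul_iSup_of_nonneg hρ0]
    exact ciSup_le hall
  exact le_of_mul_le_mul_right hmul hSpos

/-! ## Below the threshold `(1+ε₀)^5 (1−w) ≤ 1` no front survives the contraction -/

/-- `(1+ε₀)^5 (1 − w) ≤ 1` whenever `w ≤ 1` and `0 ≤ ε₀ ≤ w/5` (from `1 + x ≤ e^x`).
[folklore] -/
theorem pow_five_mul_sub_le_one {w : ℝ} (hw1 : w ≤ 1) (hε0 : 0 ≤ ε₀) (hεw : ε₀ ≤ w / 5) : (1 + ε₀) ^ 5 * (1 - w) ≤ 1 := by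
  have h1 : (1 + ε₀) ^ 5 ≤ Real.exp (5 * ε₀) := by
    have h : 1 + ε₀ ≤ Real.exp ε₀ := by linarith [Real.add_one_le_exp ε₀]
    calc (1 + ε₀) ^ 5 ≤ Real.exp ε₀ ^ 5 := pow_le_pow_left₀ (by linarith) h 5
      _ = Real.exp (5 * ε₀) := by rw [← Real.exp_nat_mul]; norm_num
  have h2 : 1 - w ≤ Real.exp (-w) := by linarith [Real.add_one_le_exp (-w)]
  calc (1 + ε₀) ^ 5 * (1 - w) ≤ Real.exp (5 * ε₀) * Real.exp (-w) :=
        mul_le_mul h1 h2 (by linarith) (Real.exp_pos _).le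
    _ = Real.exp (5 * ε₀ - w) := by rw [← Real.exp_add]; ring_nf
    _ ≤ Real.exp 0 := Real.exp_le_exp.2 (by linarith)
    _ = 1 := Real.exp_zero

/-- **No front survives the contraction.** On a cancelling table, below the threshold
`(1+ε₀)^5 (1 − w) ≤ 1` (`0 < w ≤ 1`), a uniformly bounded admissible eternal solution that is
block-self-similar with a POSITIVE lag and whose tail envelopes contract by `1 − w` per shell is
identically zero: `ϱ ≤ (1−w)^p ≤ (1+ε₀)^{-5p} = Λ^{-2p} < ϱ` is absurd.
[cite: Tao2016AveragedNS, §4 Lemma 4.1 (4.8)–(4.10), §6.4; cell vocabulary] -/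
theorem trivial_of_contraction (hε : 0 < ε₀) {α : Fin m → Fin m → Fin m → ℤ × ℤ × ℤ → ℝ}
    (hc : IsCancellingCoeff α) (hW : IsEternal ε₀ α W) (hU : UniformBound W) {p : ℕ} {T w : ℝ}
    (hT : 0 < T) (hw1 : w ≤ 1) (hthr : (1 + ε₀) ^ 5 * (1 - w) ≤ 1)
    (hD : ∀ (n : ℤ) (σ : ℝ), W (n + p) σ = W n (σ - T))
    (hContr : ∀ (n : ℤ) (M : ℝ), (∀ σ : ℝ, ∑' k : ℕ, physEnergy ε₀ W (n + k) σ ≤ M) →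
      ∀ σ : ℝ, ∑' k : ℕ, physEnergy ε₀ W (n + 1 + k) σ ≤ (1 - w) * M) :
    ∀ (n : ℤ) (σ : ℝ), W n σ = 0 := by
  intro n σ
  by_contra hne
  have h1 := ratio_le_of_contraction hε hc hW hU hD hContr hne
  have h2 := inv_sq_lt_blockRatio hε p hT
  have hq : 0 < (1 + ε₀) ^ 5 := by positivity
  -- `1 - w ≤ ((1+ε₀)^5)⁻¹`
  have h3 : 1 - w ≤ ((1 + ε₀) ^ 5)⁻¹ := by
    rw [← one_div, le_div_iff₀ hq, mul_comm]
    exact hthr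
  have h4 : (1 - w) ^ p ≤ (bigLam ε₀ ^ p)⁻¹ ^ 2 := by
    rw [inv_bigLam_pow_sq hε.le]
    exact pow_le_pow_left₀ (by linarith) h3 p
  linarith

/-! ## `TailRatchet` ⟹ no admissible DSS wave at all below threshold -/

/-- The threshold data extracted from `TailRatchet` at spread `R`: a rate `w ∈ (0, 1/2]`, a scale
threshold `ε₁ > 0` with `(1+ε₀)^5(1−w) ≤ 1` on `(0, ε₁]`, and the per-shell contraction at rate `w`
for every bounded admissible INVISCID eternal solution of every E₂(R) table.
[cite: Tao2016AveragedNS, §4 Thm. 4.2 (statement shape), §6.4; cell vocabulary] -/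
theorem threshold_of_tailRatchet
    (h : Summit.NavierStokesRegularity.NavierStokesRegularity.Theses.WakeRatchet.TailRatchet)
    {R : ℝ} (hR : 1 ≤ R) :
    ∃ w : ℝ, 0 < w ∧ w ≤ 1 ∧ ∃ ε₁ : ℝ, 0 < ε₁ ∧ ∀ ε₀ : ℝ, 0 < ε₀ → ε₀ ≤ ε₁ →
      (1 + ε₀) ^ 5 * (1 - w) ≤ 1 ∧
      ∀ α : Fin 4 → Fin 4 → Fin 4 → ℤ × ℤ × ℤ → ℝ, InTableClass R α →
        ∀ W : ℤ → ℝ → Em 4, IsEternal ε₀ α W → UniformBound W →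
          ∀ (n : ℤ) (M : ℝ), (∀ σ : ℝ, ∑' k : ℕ, physEnergy ε₀ W (n + k) σ ≤ M) →
            ∀ σ : ℝ, ∑' k : ℕ, physEnergy ε₀ W (n + 1 + k) σ ≤ (1 - w) * M := by
  obtain ⟨w, hw, εs, hεs, H⟩ := h R hR
  refine ⟨min w (1 / 2), lt_min hw (by norm_num), (min_le_right _ _).trans (by norm_num),
    min εs (min w (1 / 2) / 5), lt_min hεs (by positivity), ?_⟩
  intro ε₀ hε₀ hle
  refine ⟨pow_five_mul_sub_le_one ((min_le_right _ _).trans (by norm_num)) hε₀.le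
    (hle.trans (min_le_right _ _)), ?_⟩
  intro α hα W hW hU n M hM σ
  have hM0 : 0 ≤ M :=
    (tsum_nonneg fun k : ℕ => physEnergy_nonneg ε₀ W (n + (k : ℤ)) σ).trans (hM σ)
  have h1 := H ε₀ hε₀ (hle.trans (min_le_left _ _)) α hα 0 W hW.isEternalVisc hU n M hM σ
  exact h1.trans (mul_le_mul_of_nonneg_right (by linarith [min_le_left w (1 / 2)]) hM0)

/-- **`TailRatchet` ⟹ no block-self-similar bounded eternal solution below threshold.**  For every
spread `R ≥ 1` there is `ε₁ > 0` such that for `ε₀ ∈ (0, ε₁]` no E₂(R) table carries a non-zero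
uniformly bounded admissible inviscid eternal solution with `W_{n+p}(σ) = W_n(σ − T)` for a shell
period `p` and a POSITIVE lag `T` — whatever its residue / energy ratio.
[cite: Tao2016AveragedNS, §4 Thm. 4.2 (statement shape), Lemma 4.1 (4.8)–(4.10), §6.4; cell vocabulary] -/
theorem no_blockDSS_of_tailRatchet
    (h : Summit.NavierStokesRegularity.NavierStokesRegularity.Theses.WakeRatchet.TailRatchet) :
    ∀ R : ℝ, 1 ≤ R → ∃ ε₁ : ℝ, 0 < ε₁ ∧ ∀ ε₀ : ℝ, 0 < ε₀ → ε₀ ≤ ε₁ →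
      ∀ α : Fin 4 → Fin 4 → Fin 4 → ℤ × ℤ × ℤ → ℝ, InTableClass R α →
        ∀ (W : ℤ → ℝ → Em 4) (p : ℕ) (T : ℝ), 0 < T → IsEternal ε₀ α W → UniformBound W →
          (∀ (n : ℤ) (σ : ℝ), W (n + p) σ = W n (σ - T)) → ∀ (n : ℤ) (σ : ℝ), W n σ = 0 := by
  intro R hR
  obtain ⟨w, _hw, hw1, ε₁, hε₁, H⟩ := threshold_of_tailRatchet h hR
  refine ⟨ε₁, hε₁, fun ε₀ hε₀ hle α hα W p T hT hW hU hD => ?_⟩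
  obtain ⟨hthr, Hc⟩ := H ε₀ hε₀ hle
  exact trivial_of_contraction hε₀ hα.2.1 hW hU hT hw1 hthr hD (Hc α hα W hW hU)

/-- The eternal solution carried by a DSS wave of shape permutation `π` is block-self-similar with
shell period `orderOf π` and lag `orderOf π · T`.
[cite: Tao2016AveragedNS, §4 Lemma 4.1 (4.8); cell vocabulary (`dssEmbed`)] -/
theorem dssEmbed_shift {ρ : Type*} [Fintype ρ] (π : Equiv.Perm ρ) (T : ℝ) (Φ : ρ → ℝ → Em m)
    (r₀ : ρ) (n : ℤ) (σ : ℝ) :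
    dssEmbed π T Φ r₀ (n + (orderOf π : ℕ)) σ = dssEmbed π T Φ r₀ n (σ - orderOf π * T) := by
  unfold dssEmbed
  rw [zpow_add, zpow_natCast, pow_orderOf_eq_one, mul_one]
  push_cast
  ring_nf

/-- **`TailRatchet` ⟹ NO admissible DSS wave at all below threshold** (the tree's K1 shape with the
survival hypothesis DELETED): for every `R ≥ 1` there is `ε₁ > 0` such that for `ε₀ ∈ (0, ε₁]` every
admissible DSS wave (`IsDSSWave`: any period `q`, shape permutation `π`, delay `T > 0`) of every
E₂(R) table vanishes identically.  `TailRatchet` therefore asserts, on the DSS stratum, a LIOUVILLE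
theorem excluding all self-similar blow-up fronts — surviving or not, of any wake.
[cite: Tao2016AveragedNS, §4 Thm. 4.2 (statement shape), §6.4; cell vocabulary] -/
theorem no_dssWave_of_tailRatchet
    (h : Summit.NavierStokesRegularity.NavierStokesRegularity.Theses.WakeRatchet.TailRatchet) :
    ∀ R : ℝ, 1 ≤ R → ∃ ε₁ : ℝ, 0 < ε₁ ∧ ∀ ε₀ : ℝ, 0 < ε₀ → ε₀ ≤ ε₁ →
      ∀ α : Fin 4 → Fin 4 → Fin 4 → ℤ × ℤ × ℤ → ℝ, InTableClass R α →
        ∀ (q : ℕ) (π : Equiv.Perm (Fin q)) (T : ℝ) (Φ : Fin q → ℝ → Em 4),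
          IsDSSWave ε₀ α π T Φ → ∀ (r : Fin q) (x : ℝ), Φ r x = 0 := by
  intro R hR
  obtain ⟨ε₁, hε₁, H⟩ := no_blockDSS_of_tailRatchet h R hR
  refine ⟨ε₁, hε₁, fun ε₀ hε₀ hle α hα q π T Φ hW r x => ?_⟩
  have hp : 0 < orderOf π := orderOf_pos π
  have hT : 0 < (orderOf π : ℝ) * T := mul_pos (by exact_mod_cast hp) hW.delay_pos
  have h0 := H ε₀ hε₀ hle α hα (dssEmbed π T Φ r) (orderOf π) (orderOf π * T) hT
    (hW.isEternal_dssEmbed r) (uniformBound_dssEmbed hW r) (dssEmbed_shift π T Φ r) 0 x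
  simpa [dssEmbed] using h0

/-- In particular `TailRatchet` implies the tree's K1 predicate `NoSurvivingDSS R a` at EVERY
exponent `a` (the survival hypothesis is not used).
[cite: Tao2016AveragedNS, §4 Thm. 4.2 (statement shape), §6.4; cell vocabulary] -/
theorem noSurvivingDSS_of_tailRatchet
    (h : Summit.NavierStokesRegularity.NavierStokesRegularity.Theses.WakeRatchet.TailRatchet)
    {R : ℝ} (hR : 1 ≤ R) (a : ℝ) : NoSurvivingDSS R a := by
  obtain ⟨ε₁, hε₁, H⟩ := no_dssWave_of_tailRatchet h R hR
  exact ⟨ε₁, hε₁, fun ε₀ hε₀ hle α hα q π T Φ hW _ => H ε₀ hε₀ hle α hα q π T Φ hW⟩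

/-! ## The DSS rung `stub_rung_dss` is a Liouville statement in disguise -/

/-- **The DSS rung excludes single-profile fronts.**  The statement of the plan-only rung
`stub_rung_dss` of the registered skeleton (quoted verbatim as the hypothesis) implies: for every
`R ≥ 1` there is `ε₁ > 0` such that for `ε₀ ∈ (0, ε₁]` no E₂(R) table carries a non-zero uniformly
bounded admissible inviscid eternal solution that is shell-self-similar with a POSITIVE lag,
`W_{n+1}(σ) = W_n(σ − T)`, `T > 0` — of any wake fraction `1 − dssMu ε₀ T`.
[cite: Tao2016AveragedNS, §4 Thm. 4.2 (statement shape), Lemma 4.1 (4.8)–(4.10), §6.4; cell vocabulary] -/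
theorem no_front_of_dssRung
    (h : ∀ R : ℝ, 1 ≤ R → ∃ w : ℝ, 0 < w ∧ ∃ εs : ℝ, 0 < εs ∧ ∀ ε₀ : ℝ, 0 < ε₀ → ε₀ ≤ εs →
      ∀ α : Fin 4 → Fin 4 → Fin 4 → ℤ × ℤ × ℤ → ℝ, InTableClass R α →
        ∀ (W : ℤ → ℝ → Em 4) (T : ℝ), IsEternal ε₀ α W → UniformBound W →
          (∀ (n : ℤ) (σ : ℝ), W (n + 1) σ = W n (σ - T)) →
          ∀ (n : ℤ) (M : ℝ), (∀ σ : ℝ, ∑' k : ℕ, physEnergy ε₀ W (n + k) σ ≤ M) →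
            ∀ σ : ℝ, ∑' k : ℕ, physEnergy ε₀ W (n + 1 + k) σ ≤ (1 - w) * M) :
    ∀ R : ℝ, 1 ≤ R → ∃ ε₁ : ℝ, 0 < ε₁ ∧ ∀ ε₀ : ℝ, 0 < ε₀ → ε₀ ≤ ε₁ →
      ∀ α : Fin 4 → Fin 4 → Fin 4 → ℤ × ℤ × ℤ → ℝ, InTableClass R α →
        ∀ (W : ℤ → ℝ → Em 4) (T : ℝ), 0 < T → IsEternal ε₀ α W → UniformBound W →
          (∀ (n : ℤ) (σ : ℝ), W (n + 1) σ = W n (σ - T)) → ∀ (n : ℤ) (σ : ℝ), W n σ = 0 := by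
  intro R hR
  obtain ⟨w, hw, εs, hεs, H⟩ := h R hR
  set w' : ℝ := min w (1 / 2) with hw'
  have hw'0 : 0 < w' := lt_min hw (by norm_num)
  have hw'1 : w' ≤ 1 := (min_le_right _ _).trans (by norm_num)
  refine ⟨min εs (w' / 5), lt_min hεs (by positivity), fun ε₀ hε₀ hle α hα W T hT hW hU hD => ?_⟩
  have hthr : (1 + ε₀) ^ 5 * (1 - w') ≤ 1 :=
    pow_five_mul_sub_le_one hw'1 hε₀.le (hle.trans (min_le_right _ _))
  have hD' : ∀ (n : ℤ) (σ : ℝ), W (n + (1 : ℕ)) σ = W n (σ - T) := fun n σ => by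
    simpa using hD n σ
  refine trivial_of_contraction hε₀ hα.2.1 hW hU hT hw'1 hthr hD' ?_
  intro n M hM σ
  have hM0 : 0 ≤ M :=
    (tsum_nonneg fun k : ℕ => physEnergy_nonneg ε₀ W (n + (k : ℤ)) σ).trans (hM σ)
  have h1 := H ε₀ hε₀ (hle.trans (min_le_left _ _)) α hα W T hW hU hD n M hM σ
  exact h1.trans (mul_le_mul_of_nonneg_right (by linarith [min_le_left w (1 / 2)]) hM0)

/-- **Kill criterion for the DSS rung.**  Single-profile admissible non-trivial DSS fronts
(`IsDSSWave` with one profile, `q = 1`) on E₂(R) tables at arbitrarily small scale ratios refute the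
statement of `stub_rung_dss`. [cite: Tao2016AveragedNS, §4; cell vocabulary] -/
theorem not_dssRung_of_persistent_fronts {R : ℝ} (hR : 1 ≤ R)
    (hF : ∀ ε : ℝ, 0 < ε → ∃ ε₀ : ℝ, 0 < ε₀ ∧ ε₀ ≤ ε ∧
      ∃ α : Fin 4 → Fin 4 → Fin 4 → ℤ × ℤ × ℤ → ℝ, InTableClass R α ∧
        ∃ (T : ℝ) (Φ : Fin 1 → ℝ → Em 4), IsDSSWave ε₀ α 1 T Φ ∧ ∃ x, Φ 0 x ≠ 0) :
    ¬ (∀ R : ℝ, 1 ≤ R → ∃ w : ℝ, 0 < w ∧ ∃ εs : ℝ, 0 < εs ∧ ∀ ε₀ : ℝ, 0 < ε₀ → ε₀ ≤ εs →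
      ∀ α : Fin 4 → Fin 4 → Fin 4 → ℤ × ℤ × ℤ → ℝ, InTableClass R α →
        ∀ (W : ℤ → ℝ → Em 4) (T : ℝ), IsEternal ε₀ α W → UniformBound W →
          (∀ (n : ℤ) (σ : ℝ), W (n + 1) σ = W n (σ - T)) →
          ∀ (n : ℤ) (M : ℝ), (∀ σ : ℝ, ∑' k : ℕ, physEnergy ε₀ W (n + k) σ ≤ M) →
            ∀ σ : ℝ, ∑' k : ℕ, physEnergy ε₀ W (n + 1 + k) σ ≤ (1 - w) * M) := by
  intro h
  obtain ⟨ε₁, hε₁, H⟩ := no_front_of_dssRung h R hR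
  obtain ⟨ε₀, hε₀, hle, α, hα, T, Φ, hW, x, hne⟩ := hF ε₁ hε₁
  have hD : ∀ (n : ℤ) (σ : ℝ), dssEmbed 1 T Φ 0 (n + 1) σ = dssEmbed 1 T Φ 0 n (σ - T) := by
    intro n σ
    unfold dssEmbed
    simp only [one_zpow, Equiv.Perm.one_apply]
    push_cast
    ring_nf
  have h0 := H ε₀ hε₀ hle α hα (dssEmbed 1 T Φ 0) T hW.delay_pos (hW.isEternal_dssEmbed 0)
    (uniformBound_dssEmbed hW 0) hD 0 x
  exact hne (by simpa [dssEmbed] using h0)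

end WakeRatchetDSS

end Summit.NavierStokesRegularity.NavierStokesRegularity.Theorems

end
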